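import Summits.HubbardSuperconductivity.HubbardSuperconductivity.Theorems.AnisotropyChordTransferFibre3RowCDrops
import Summits.HubbardSuperconductivity.HubbardSuperconductivity.Theorems.AnisotropyChordTransferFibre3GroundSup

/-!
# Route `AnisotropyChord` / H0 rotor rung: PartN41-C §2 — `Q0Crude` PROVED (`|s| ≤ σ` off the origin and the crude `Q₀` bound)

Theory-1 g22's PartN41-C §2 `Q0Crude` (port …Fibre3KT2bRow): for the ground profile (`L ≥ 5`, `0 ≤ Δ < 1`), with
`a = Δ f_nn`, `σ = 1 − a + 2a/V`: ★ `|s(r)| ≤ σ` for `r ≠ 0` and `f ≤ 2 − a + 2a/V` everywhere (from the landed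
`ground_ge_delta_mul : a ≤ f(r)` and `ground_le_two' : f ≤ 2 − a(1 − 2/V)`, …Fibre3GroundSup), hence with the `Q₀` expansion
(`RowC.q0_expansion`) and `−4s³ ≤ 4σs²`, `s⁴ ≤ σ²s²`: ★ `Q₀ ≤ V + 3 + (6 + 4σ + σ²)·Σ′s²`.
★ `RowC.q0_crude`, ★ `q0Crude_holds (Δ) : Q0Crude L Δ`.
Prover seat `hubbard-h0-rotor-p1` g27 (route lead); helper for stmt-HubbardSuperconductivity-23918 (`--supports`, helper class).
WHAT THIS IS NOT: nothing here proves superconductivity in the Hubbard model; a crude bound on one input of ONE row of ONE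
conditional reduction.  Tree imports only; no new definitions; no sorry, no axioms.
-/

set_option linter.dupNamespace false
set_option autoImplicit false

noncomputable section

open scoped BigOperators

namespace Summit.HubbardSuperconductivity.HubbardSuperconductivity.Theorems.AnisotropyChord.Transfer.Fibre3

variable (L : ℕ) [NeZero L]

namespace RowC

/-- `|s(r)| ≤ σ = 1 − a + 2a/V` off the origin. [folklore] -/
theorem abs_s_le (hL : 5 ≤ L) {Δ lam2 : ℝ} (hΔ0 : 0 ≤ Δ) (hΔ1 : Δ < 1) {f : Tor L → ℝ}
    (hf : IsGroundTwoMagnon L Δ lam2 f) {r : Tor L} (hr : r ≠ 0) :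
    |sfun L Δ f r| ≤ 1 - Δ * f (K1 L) + 2 * (Δ * f (K1 L)) / (L : ℝ) ^ 2 := by
  have h1 := ground_ge_delta_mul L hL hΔ0 hΔ1 hf hr
  have h2 := ground_le_two' L hL hΔ0 hΔ1 hf r
  have hfnn : 0 < f (K1 L) := hf.1.2.2.1
  have hL0 : (0 : ℝ) < L := by exact_mod_cast (show 0 < L by omega)
  have ha : 0 ≤ 2 * (Δ * f (K1 L)) / (L : ℝ) ^ 2 := by positivity
  unfold sfun
  rw [if_neg hr, abs_le]
  constructor
  · have e : Δ * f (K1 L) * (1 - 2 / (L : ℝ) ^ 2) = Δ * f (K1 L) - 2 * (Δ * f (K1 L)) / (L : ℝ) ^ 2 := by ring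
    linarith
  · linarith

/-- pointwise: `|s| ≤ σ` ⇒ `6s² − 4s³ + s⁴ ≤ (6 + 4σ + σ²)s²`. [folklore] -/
theorem poly_le {s σ : ℝ} (h : |s| ≤ σ) : 6 * s ^ 2 - 4 * s ^ 3 + s ^ 4 ≤ (6 + 4 * σ + σ ^ 2) * s ^ 2 := by
  obtain ⟨h1, h2⟩ := abs_le.mp h
  have hσ : 0 ≤ σ := (abs_nonneg s).trans h
  have hs2 : 0 ≤ s ^ 2 := sq_nonneg s
  have e1 : s ^ 2 ≤ σ ^ 2 := by nlinarith
  have e2 : s ^ 4 ≤ σ ^ 2 * s ^ 2 := by nlinarith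
  have e3 : -s ^ 3 ≤ σ * s ^ 2 := by nlinarith
  nlinarith

/-- ★ the body of `Q0Crude L Δ`. [folklore] -/
theorem q0_crude (hL : 5 ≤ L) {Δ lam2 : ℝ} (hΔ0 : 0 ≤ Δ) (hΔ1 : Δ < 1) {f : Tor L → ℝ}
    (hf : IsGroundTwoMagnon L Δ lam2 f) :
    let a : ℝ := Δ * f (K1 L)
    let σ : ℝ := 1 - a + 2 * a / (L : ℝ) ^ 2
    (∀ r : Tor L, r ≠ 0 → |sfun L Δ f r| ≤ σ) ∧
    (∀ r : Tor L, f r ≤ 2 - a + 2 * a / (L : ℝ) ^ 2) ∧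
    Q0 L f ≤ (L : ℝ) ^ 2 + 3 + (6 + 4 * σ + σ ^ 2) * (∑ r ∈ (Finset.univ : Finset (Tor L)).erase 0, sfun L Δ f r ^ 2) := by
  intro a σ
  have hs : ∀ r : Tor L, r ≠ 0 → |sfun L Δ f r| ≤ σ := fun r hr => abs_s_le L hL hΔ0 hΔ1 hf hr
  refine ⟨hs, fun r => ?_, ?_⟩
  · have h2 := ground_le_two' L hL hΔ0 hΔ1 hf r
    have e : Δ * f (K1 L) * (1 - 2 / (L : ℝ) ^ 2) = a - 2 * a / (L : ℝ) ^ 2 := by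
      show Δ * f (K1 L) * (1 - 2 / (L : ℝ) ^ 2) = Δ * f (K1 L) - 2 * (Δ * f (K1 L)) / (L : ℝ) ^ 2
      ring
    linarith
  · obtain ⟨-, hQ⟩ := q0_expansion L hf.1
    rw [hQ]
    have hpt : ∀ r ∈ (Finset.univ : Finset (Tor L)).erase 0,
        6 * sfun L Δ f r ^ 2 - 4 * sfun L Δ f r ^ 3 + sfun L Δ f r ^ 4 ≤ (6 + 4 * σ + σ ^ 2) * sfun L Δ f r ^ 2 :=
      fun r hr => poly_le (hs r (Finset.ne_of_mem_erase hr))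
    have hsum := Finset.sum_le_sum hpt
    rw [Finset.sum_add_distrib, Finset.sum_sub_distrib, ← Finset.mul_sum, ← Finset.mul_sum, ← Finset.mul_sum] at hsum
    linarith

end RowC

/-- ★ **`Q0Crude L Δ` holds.** [folklore] -/
theorem q0Crude_holds (Δ : ℝ) : Q0Crude L Δ :=
  fun _ _ hL hΔ0 hΔ1 hf => RowC.q0_crude L hL hΔ0 hΔ1 hf

end Summit.HubbardSuperconductivity.HubbardSuperconductivity.Theorems.AnisotropyChord.Transfer.Fibre3

end
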